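import Literature.NumberTheory.DiophantineGeometry.GenEllConjugatePersistent
import Literature.NumberTheory.DiophantineGeometry.GenEllDePersistentFamilyInfinite
import Literature.NumberTheory.DiophantineGeometry.GenEllMechanismFor
import Literature.NumberTheory.DiophantineGeometry.GenEllMechanismKappa
import Summits.ABC.ABC.Theses.IUTThetaPilot
import HarnessLib

set_option linter.dupNamespace false

/-!
# Route `route-ABC-IUTThetaPilot`, support item `GenEllTwo` (stmt-ABC-19679) — CLOSED
# [GenEll] Thm. 2.1, (ii) ⇒ (i) at `Σ = {2}` for `(ℙ¹, [0]+[1]+[∞])`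

S. Mochizuki, *Arithmetic elliptic curves in general position*, Math. J. Okayama Univ. **52** (2010),
Thm. 2.1, proof pp. 12–13 [cite: MochizukiGenEll2010, Thm 2.1 pp.11–13]: "it follows immediately from
the compactness of the set of rational points … over any finite extension of `ℚ_v` for `v ∈ V`, together
with the existence of noncritical Belyi maps, that there exists a finite collection of noncritical Belyi
maps …" — here, for `X = ℙ¹ ∖ {0,1,∞}` and `V = {∞, 2}`, in the cell's number-field-only architecture
(abc-iut, package GENELLTWO-P1ROUTE v3, owner abc-iut-S6): the Galois cover `Y → X` of p. 12 is the
superelliptic curve `D_e : r^e = x(1−x)` (`e = 2k+1`, `e/(e−3) < 1+ε`), the noncritical Belyi maps are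
`β ∘ t_c` for the one-parameter family `t_c = 1/r + c·r^{k+1}/(1−2x)` (`c ∈ 2^ℕ`, `2d+1` parameters with
pairwise coprime PERSISTENT polynomials — the points no map of parameter `c` can be made noncritical at)
and Belyi pairs on `ℙ¹` protecting a prescribed finite set, and the compactness step is the single-place
finite-subcover spine at `p = 2`.

This file is the CLOSING COMPOSITION only (every mathematical step lives in `Literature/`):
`ε ↦ k` (`genEllTwo_exists_k`) ↦ the menu `DeFamily.exists_persistent_polys_mem ℂ (PadicAlgCl 2)`
(`GenEllDePersistentFamilyInfinite`) ↦ the mechanism `mechanismFor_of_kappa` (`GenEllMechanismFor`,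
abc-iut-w5-d075: for each parameter and each protection polynomial, a bad polynomial `g` coprime to it
and the Vojta inequality in degree `≤ d` on the points all of whose conjugates at `∞` and at `2` are
`r`-far from the roots of `g`, MODULO the conductor bound `hKappa`) with `hKappa` DISCHARGED by
`exists_condBound_mechanism` (`GenEllMechanismKappa`, abc-iut-w5-d045: the sharp-Prop.-1.6 slope of
the reduced fibre — good places, and slope-one DEFECTS at every bad place, OWNER RULING #7: no
separation at odd primes) ↦ the spine `vojtaIneq_univ_of_persistent` (`GenEllConjugatePersistent`,
`p := 2`, `2d < 2d+1`).
Classical; the item is the route's formalisation debt for a refereed theorem and bears on nothing disputed.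
-/

noncomputable section

open Polynomial
open Literature.NumberTheory.DiophantineGeometry
open Literature.NumberTheory.DiophantineGeometry.GenEll

namespace Summit.ABC.ABC.Theorems

/-- `e = 2k+1` with `k ≥ 3` and `e/(e−3) < 1 + ε`: the ramification index of the cover `D_e → ℙ¹`
chosen from `ε` ([GenEll] p. 12, "`ε'` sufficiently small"; here `e` sufficiently large).
[cite: MochizukiGenEll2010, Thm 2.1 p.12] -/
theorem genEllTwo_exists_k {ε : ℝ} (hε : 0 < ε) :
    ∃ k : ℕ, 3 ≤ k ∧ ((2 * k + 1 : ℕ) : ℝ) / (((2 * k + 1 : ℕ) : ℝ) - 3) < 1 + ε := by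
  obtain ⟨m, hm⟩ := exists_nat_gt (3 / (2 * ε))
  refine ⟨m + 3, by omega, ?_⟩
  have hpos : (0 : ℝ) < ((2 * (m + 3) + 1 : ℕ) : ℝ) - 3 := by push_cast; linarith
  rw [div_lt_iff₀ hpos]
  push_cast
  have h1 : 3 < 2 * ε * (m : ℝ) := by
    have := (div_lt_iff₀ (by positivity : (0 : ℝ) < 2 * ε)).1 hm
    linarith
  nlinarith

/-- **[GenEll] Theorem 2.1, (ii) ⟹ (i), at `Σ = {2}` for `(ℙ¹_ℚ, [0]+[1]+[∞])`** — the route's support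
item `GenEllTwo`: `ABCCompactlyBounded {2} → ∀ d ≥ 1, VojtaP1Deg d`. PROVED (closing composition; see
the module docstring for the chain). [cite: MochizukiGenEll2010, Thm 2.1 pp.11–13] -/
theorem genEllTwo_holds : Summit.ABC.ABC.Theses.IUTThetaPilot.GenEllTwo := by
  unfold Summit.ABC.ABC.Theses.IUTThetaPilot.GenEllTwo
  intro h2 d hd ε hε
  obtain ⟨k, hk, hke⟩ := genEllTwo_exists_k hε
  haveI : Fact (Nat.Prime 2) := ⟨Nat.prime_two⟩
  have hpool : (Set.range fun j : ℕ => (2 : ℚ) ^ j).Infinite :=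
    Set.infinite_range_of_injective (pow_right_injective₀ (by norm_num) (by norm_num))
  obtain ⟨c, Pers, hcC, hc0, _hinj, hP0, hcop, hroots₁, _hroots₂⟩ :=
    DeFamily.exists_persistent_polys_mem ℂ (PadicAlgCl 2) hk _ hpool (2 * d + 1)
  refine vojtaIneq_univ_of_persistent 2 d Pers hP0 hcop (by simp) ?_
  intro i q hq hqP
  have hk1 : 1 ≤ k := by omega
  exact mechanismFor_of_kappa h2 hd hε hk hke (hcC i) (hroots₁ i)
    (fun φ hdeg hnum hden hsub hAB hcard K _ _ hKR hKB Nd _ρ hρ =>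
      exists_condBound_mechanism k hk1 (hc0 i) φ hdeg hnum hden hsub hAB hcard K hKR hKB Nd hρ)
    q hq hqP

end Summit.ABC.ABC.Theorems

end
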